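import Mathlib
import Summits.ValiantsHypothesis.ValiantsHypothesis.Theorems.LacunarySymmetroidMatrixDescartesDefiniteMomentsBudgetZones
import Summits.ValiantsHypothesis.ValiantsHypothesis.Theorems.LacunarySymmetroidMatrixDescartesDefiniteMomentsRayleigh

/-!
# `MatrixDescartes` (stmt-ValiantsHypothesis-18050) — the DEFINITE-MOMENTS LAW, budget zones V: THE INTRINSIC WORD LAW —
# a semidefinite sign word whose Rayleigh polynomials are all Descartes-sharp has `Z₊ ≤ V·m`

HONEST FRAMING.  Cell `pub-symmetroid`, seat `val-sym-mdr-p2` (gen 15); helper file `--supports` the crux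
`Theses.LacunarySymmetroid.MatrixDescartes`, NO closure claim.  An INTRINSIC sector law beside the crux: g14's word law
(`card_posRoots_le_of_wordMoments`: semidefinite sign word with `V` sign changes + `V − 1` INTERIOR alternating definite moments
⇒ `Z₊ ≤ V·m`) with the test points REMOVED — the alternating definite scales are produced by the zone machinery
(`…BudgetZones`).  Nothing here bears on the crux in its window, on `stub_twoSided`, on `DoorA26`/`DoorA34`, registers, or
`VP ≠ VNP`.

SETTING.  Letters `Sₗ` (`l : Fin K`, ANY exponents `dₗ`), a monotone block map `β : ℕ → ℕ` with `(−1)^{β(dₗ)} Sₗ ⪰ 0`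
(SEMIDEFINITE SIGN WORD), a base block `b₀ ≤ β(dₗ) ≤ b₀ + V` for all `l` (so every Rayleigh polynomial `P_u` has at most `V`
sign changes).  HYPOTHESIS: every `P_u` (`u ≠ 0`) has at least `V ≥ 1` distinct positive roots.
* `word_budget` / `word_sign`: the budget bundle of `…BudgetRayleigh` holds with `B = V`, `s = (−1)^{b₀}` (Descartes with
  multiplicity under the sign pattern; the first visible block of every `P_u` is `b₀`, forced by sharpness);
* **`card_posRoots_le_of_wordSharp`: `Z₊(det F) ≤ V·card ι`** (symmetric letters). [folklore]; axioms standard; no definitions.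
-/

-- layout Summits/ValiantsHypothesis/ValiantsHypothesis forces the duplicated namespace component
set_option linter.dupNamespace false

namespace Summit.ValiantsHypothesis.ValiantsHypothesis.Theorems.LacunarySymmetroidMatrixDescartes

open Polynomial Matrix Finset
open scoped BigOperators

namespace DefiniteMoments

section Word

variable {ι : Type} [Fintype ι] {K : ℕ}

/-- The exponents of the monomials of a Rayleigh `K`-nomial are among the `dₗ`. [folklore] -/
theorem exists_exp_of_mem_support (d : Fin K → ℕ) (S : Fin K → Matrix ι ι ℝ) (u : ι → ℝ) {n : ℕ}
    (hn : n ∈ (∑ l, C (u ⬝ᵥ (S l *ᵥ u)) * (X : ℝ[X]) ^ d l).support) : ∃ l, n = d l := by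
  by_contra h
  push Not at h
  rw [Polynomial.mem_support_iff, coeff_rayleighPoly] at hn
  exact hn (Finset.sum_eq_zero fun l _ => if_neg (h l))

/-- **Descartes under the word: `Var(P_u) + β(first visible block) ≤ b₀ + V`.** [folklore] -/
theorem word_signVariations_le (d : Fin K → ℕ) (S : Fin K → Matrix ι ι ℝ) (β : ℕ → ℕ) (hβ : Monotone β)
    (hsign : ∀ l, (((-1 : ℝ) ^ β (d l)) • S l).PosSemidef) (b₀ V : ℕ) (hhi : ∀ l, β (d l) ≤ b₀ + V) (u : ι → ℝ)
    (hP : (∑ l, C (u ⬝ᵥ (S l *ᵥ u)) * (X : ℝ[X]) ^ d l) ≠ 0) :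
    (∑ l, C (u ⬝ᵥ (S l *ᵥ u)) * (X : ℝ[X]) ^ d l).signVariations
      + β (∑ l, C (u ⬝ᵥ (S l *ᵥ u)) * (X : ℝ[X]) ^ d l).natTrailingDegree ≤ b₀ + V := by
  set P := ∑ l, C (u ⬝ᵥ (S l *ᵥ u)) * (X : ℝ[X]) ^ d l with hPdef
  have h1 := signVariations_add_le_of_signPattern β hβ _ P le_rfl hP (rayleighPoly_signPattern d S β hsign u)
    (β P.natTrailingDegree) (fun n hn => hβ (Polynomial.natTrailingDegree_le_of_mem_supp n hn))
  obtain ⟨l, hl⟩ := exists_exp_of_mem_support d S u (Polynomial.natDegree_mem_support_of_nonzero hP)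
  have h2 : β P.natDegree ≤ b₀ + V := by rw [hl]; exact hhi l
  omega

/-- **The word's budget** (`hB` of the bundle with `B = V`): every `P_u` has at most `V` positive roots counted with
multiplicity. [folklore] -/
theorem word_budget (d : Fin K → ℕ) (S : Fin K → Matrix ι ι ℝ) (β : ℕ → ℕ) (hβ : Monotone β)
    (hsign : ∀ l, (((-1 : ℝ) ^ β (d l)) • S l).PosSemidef) (b₀ V : ℕ) (hlo : ∀ l, b₀ ≤ β (d l))
    (hhi : ∀ l, β (d l) ≤ b₀ + V) (u : ι → ℝ) :
    ((∑ l, C (u ⬝ᵥ (S l *ᵥ u)) * (X : ℝ[X]) ^ d l).roots.filter (fun t => 0 < t)).card ≤ V := by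
  set P := ∑ l, C (u ⬝ᵥ (S l *ᵥ u)) * (X : ℝ[X]) ^ d l with hPdef
  by_cases hP : P = 0
  · rw [hP, Polynomial.roots_zero, Multiset.filter_zero, Multiset.card_zero]; exact Nat.zero_le _
  have h1 := word_signVariations_le d S β hβ hsign b₀ V hhi u hP
  obtain ⟨l, hl⟩ := exists_exp_of_mem_support d S u (Polynomial.natTrailingDegree_mem_support_of_nonzero hP)
  have h2 : b₀ ≤ β P.natTrailingDegree := by rw [← hPdef] at hl; rw [hl]; exact hlo l
  have h3 : (P.roots.filter (fun t => 0 < t)).card ≤ P.signVariations := by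
    rw [← Multiset.countP_eq_card_filter]; exact P.roots_countP_pos_le_signVariations
  rw [← hPdef] at h1
  omega

/-- **The word's sign** (`hs` of the bundle with `s = (−1)^{b₀}`): if `P_u` (`u ≠ 0`) has `V` distinct positive roots then its
first visible block is `b₀`, so `P_u` has the sign `(−1)^{b₀}` near `0⁺`. [folklore] -/
theorem word_sign (d : Fin K → ℕ) (S : Fin K → Matrix ι ι ℝ) (β : ℕ → ℕ) (hβ : Monotone β)
    (hsign : ∀ l, (((-1 : ℝ) ^ β (d l)) • S l).PosSemidef) (b₀ V : ℕ) (hV1 : 1 ≤ V) (hlo : ∀ l, b₀ ≤ β (d l))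
    (hhi : ∀ l, β (d l) ≤ b₀ + V)
    (hV : ∀ u : ι → ℝ, u ≠ 0 →
      V ≤ ((∑ l, C (u ⬝ᵥ (S l *ᵥ u)) * (X : ℝ[X]) ^ d l).roots.toFinset.filter (fun t => 0 < t)).card)
    (u : ι → ℝ) (hu : u ≠ 0) :
    ∃ δ : ℝ, 0 < δ ∧ ∀ x : ℝ, 0 < x → x < δ →
      0 < (-1 : ℝ) ^ b₀ * (∑ l, C (u ⬝ᵥ (S l *ᵥ u)) * (X : ℝ[X]) ^ d l).eval x := by
  set P := ∑ l, C (u ⬝ᵥ (S l *ᵥ u)) * (X : ℝ[X]) ^ d l with hPdef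
  have hcard := hV u hu
  have hP : P ≠ 0 := by
    intro h0
    rw [← hPdef, h0, Polynomial.roots_zero, Multiset.toFinset_zero, Finset.filter_empty, Finset.card_empty] at hcard
    omega
  -- the first visible block is `b₀`
  have h1 := word_signVariations_le d S β hβ hsign b₀ V hhi u hP
  obtain ⟨l, hl⟩ := exists_exp_of_mem_support d S u (Polynomial.natTrailingDegree_mem_support_of_nonzero hP)
  have h2 : b₀ ≤ β P.natTrailingDegree := by rw [← hPdef] at hl; rw [hl]; exact hlo l
  have h3 : (P.roots.toFinset.filter (fun t => 0 < t)).card ≤ P.signVariations :=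
    calc (P.roots.toFinset.filter (fun t => 0 < t)).card
        = (P.roots.filter (fun t => 0 < t)).toFinset.card := by rw [Multiset.toFinset_filter]
      _ ≤ (P.roots.filter (fun t => 0 < t)).card := Multiset.toFinset_card_le _
      _ = P.roots.countP (fun t => 0 < t) := (Multiset.countP_eq_card_filter _ _).symm
      _ ≤ P.signVariations := P.roots_countP_pos_le_signVariations
  rw [← hPdef] at h1 hcard
  have hb : β P.natTrailingDegree = b₀ := by omega
  -- a point where the Rayleigh form is non-zero, then g14's near-zero sign
  obtain ⟨x₀, hx₀⟩ : ∃ x₀ : ℝ, u ⬝ᵥ ((∑ k, x₀ ^ d k • S k) *ᵥ u) ≠ 0 := by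
    by_contra h
    push Not at h
    apply hP
    refine Polynomial.funext fun x => ?_
    rw [hPdef, eval_rayleighPoly, h x, Polynomial.eval_zero]
  obtain ⟨δ, hδ, hnear⟩ := rayleigh_word_near_zero d S β hsign u hx₀
  refine ⟨δ, hδ, fun x hx hxδ => ?_⟩
  have h := hnear x hx hxδ
  rw [← hPdef, hb, ← eval_rayleighPoly] at h
  exact h

/-- **THE INTRINSIC WORD LAW.**  `F(x) = ∑ₗ x^{dₗ} Sₗ` with real symmetric letters (any exponents) carrying a semidefinite sign
word — a monotone block map `β` with `(−1)^{β(dₗ)} Sₗ ⪰ 0` and `b₀ ≤ β(dₗ) ≤ b₀ + V` (at most `V ≥ 1` sign changes).  If every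
Rayleigh polynomial `∑ₗ (uᵀSₗu)X^{dₗ}` (`u ≠ 0`) has at least `V` distinct positive roots, then `det F` has at most `V·card ι`
distinct positive zeros.  (g14's word law `card_posRoots_le_of_wordMoments` without test points: the `V + 1` alternating
definite scales exist by the zone machinery.) [folklore] -/
theorem card_posRoots_le_of_wordSharp [DecidableEq ι] (d : Fin K → ℕ) (S : Fin K → Matrix ι ι ℝ)
    (hS : ∀ l, (S l).IsSymm) (β : ℕ → ℕ) (hβ : Monotone β) (hsign : ∀ l, (((-1 : ℝ) ^ β (d l)) • S l).PosSemidef)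
    (b₀ V : ℕ) (hV1 : 1 ≤ V) (hlo : ∀ l, b₀ ≤ β (d l)) (hhi : ∀ l, β (d l) ≤ b₀ + V)
    (hV : ∀ u : ι → ℝ, u ≠ 0 →
      V ≤ ((∑ l, C (u ⬝ᵥ (S l *ᵥ u)) * (X : ℝ[X]) ^ d l).roots.toFinset.filter (fun t => 0 < t)).card) :
    ((Matrix.det (∑ k, ((X : ℝ[X]) ^ d k) • (S k).map C)).roots.toFinset.filter (fun t => 0 < t)).card
      ≤ V * Fintype.card ι :=
  budget_card_posRoots_le d S hS V ((-1) ^ b₀) (word_budget d S β hβ hsign b₀ V hlo hhi) hV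
    (word_sign d S β hβ hsign b₀ V hV1 hlo hhi hV)

/-- **Alternating definite scales for a sharp word** (the scales g14's word law takes as input are OUTPUT here): there are
`0 < a₀ < ⋯ < a_V` with `(−1)^{b₀+j}·vᵀF(aⱼ)v > 0` for all `v ≠ 0`. [folklore] -/
theorem exists_alternatingScales_of_wordSharp (d : Fin K → ℕ) (S : Fin K → Matrix ι ι ℝ)
    (hS : ∀ l, (S l).IsSymm) (β : ℕ → ℕ) (hβ : Monotone β) (hsign : ∀ l, (((-1 : ℝ) ^ β (d l)) • S l).PosSemidef)
    (b₀ V : ℕ) (hV1 : 1 ≤ V) (hlo : ∀ l, b₀ ≤ β (d l)) (hhi : ∀ l, β (d l) ≤ b₀ + V)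
    (hV : ∀ u : ι → ℝ, u ≠ 0 →
      V ≤ ((∑ l, C (u ⬝ᵥ (S l *ᵥ u)) * (X : ℝ[X]) ^ d l).roots.toFinset.filter (fun t => 0 < t)).card) :
    ∃ a : Fin (V + 1) → ℝ, StrictMono a ∧ 0 < a 0 ∧
      ∀ (j : Fin (V + 1)) (v : ι → ℝ), v ≠ 0 →
        0 < (-1 : ℝ) ^ b₀ * (-1) ^ (j : ℕ) * (v ⬝ᵥ ((∑ k, a j ^ d k • S k) *ᵥ v)) :=
  budget_exists_alternatingScales d S hS V hV1 ((-1) ^ b₀) (word_budget d S β hβ hsign b₀ V hlo hhi) hV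
    (word_sign d S β hβ hsign b₀ V hV1 hlo hhi hV)

end Word

end DefiniteMoments

end Summit.ValiantsHypothesis.ValiantsHypothesis.Theorems.LacunarySymmetroidMatrixDescartes
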